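import Mathlib

/-!
# The first-order one-pair bracket in centred form (LEMMA A of PROOFS §P54, lane prim-rate (c), row M2-R54)

For the one-pair expansion `covD = Cov_ν − t·M + t²·Q` (`CSH.covD_onePair_eq`) the first-order bracket is
`M = E[TFG] + E[T]·E[FG] − E[F]·E[TG] − E[G]·E[TF]`.  This file records the purely algebraic identity

  `M = (1 + E T)·(E[FG] − E F·E G) − E[(1 − T)·(F − E F)·(G − E G)]`,

valid for any three real integrable functions on a probability space (all the products integrable).  With
`T = 1{a ∈ 𝒞_x}` it says `1 + c = E[1{a ∉ 𝒞_x}·F̃·G̃]/Cov(F,G) − E T` for the first-order constant `c = −M/Cov`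
of every graph, and on the `{x,a}`-separator class it factorises into the separator identity
`M = Cov − (1−ρ)·φ_L·φ_R` (PROOFS §P54 (a)).
-/

open MeasureTheory

namespace CSH

/-- **LEMMA A (centred form of the one-pair bracket).**  On a probability space, for real functions
`T, F, G` with `T, F, G, T·F, T·G, F·G, T·F·G` integrable,
`∫TFG + ∫T·∫FG − ∫F·∫TG − ∫G·∫TF = (1 + ∫T)·(∫FG − ∫F·∫G) − ∫(1 − T)(F − ∫F)(G − ∫G)`. -/
theorem onePairBracket_eq_centered {Ω : Type*} [MeasurableSpace Ω] (μ : Measure Ω)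
    [IsProbabilityMeasure μ] (T F G : Ω → ℝ) (hT : Integrable T μ) (hF : Integrable F μ)
    (hG : Integrable G μ) (hTF : Integrable (fun ω => T ω * F ω) μ)
    (hTG : Integrable (fun ω => T ω * G ω) μ) (hFG : Integrable (fun ω => F ω * G ω) μ)
    (hTFG : Integrable (fun ω => T ω * (F ω * G ω)) μ) :
    (∫ ω, T ω * (F ω * G ω) ∂μ) + (∫ ω, T ω ∂μ) * (∫ ω, F ω * G ω ∂μ)
        - (∫ ω, F ω ∂μ) * (∫ ω, T ω * G ω ∂μ) - (∫ ω, G ω ∂μ) * (∫ ω, T ω * F ω ∂μ)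
      = (1 + ∫ ω, T ω ∂μ) * ((∫ ω, F ω * G ω ∂μ) - (∫ ω, F ω ∂μ) * (∫ ω, G ω ∂μ))
        - ∫ ω, (1 - T ω) * ((F ω - ∫ ω', F ω' ∂μ) * (G ω - ∫ ω', G ω' ∂μ)) ∂μ := by
  set a : ℝ := ∫ ω, F ω ∂μ with ha
  set b : ℝ := ∫ ω, G ω ∂μ with hb
  set t : ℝ := ∫ ω, T ω ∂μ with ht
  -- expand the centred integrand into eight integrable pieces
  have hexp : (fun ω => (1 - T ω) * ((F ω - a) * (G ω - b))) =
      fun ω => F ω * G ω + (-a) * G ω + (-b) * F ω + a * b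
        + (-1) * (T ω * (F ω * G ω)) + a * (T ω * G ω) + b * (T ω * F ω) + (-(a * b)) * T ω := by
    funext ω; ring
  have h1 : Integrable (fun ω => F ω * G ω + (-a) * G ω) μ := hFG.add (hG.const_mul _)
  have h2 : Integrable (fun ω => F ω * G ω + (-a) * G ω + (-b) * F ω) μ := h1.add (hF.const_mul _)
  have h3 : Integrable (fun ω => F ω * G ω + (-a) * G ω + (-b) * F ω + a * b) μ :=
    h2.add (integrable_const _)
  have h4 : Integrable (fun ω => F ω * G ω + (-a) * G ω + (-b) * F ω + a * b
      + (-1) * (T ω * (F ω * G ω))) μ := h3.add (hTFG.const_mul _)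
  have h5 : Integrable (fun ω => F ω * G ω + (-a) * G ω + (-b) * F ω + a * b
      + (-1) * (T ω * (F ω * G ω)) + a * (T ω * G ω)) μ := h4.add (hTG.const_mul _)
  have h6 : Integrable (fun ω => F ω * G ω + (-a) * G ω + (-b) * F ω + a * b
      + (-1) * (T ω * (F ω * G ω)) + a * (T ω * G ω) + b * (T ω * F ω)) μ :=
    h5.add (hTF.const_mul _)
  have hI : ∫ ω, (1 - T ω) * ((F ω - a) * (G ω - b)) ∂μ =
      (∫ ω, F ω * G ω ∂μ) + (-a) * b + (-b) * a + a * b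
        + (-1) * (∫ ω, T ω * (F ω * G ω) ∂μ) + a * (∫ ω, T ω * G ω ∂μ)
        + b * (∫ ω, T ω * F ω ∂μ) + (-(a * b)) * t := by
    rw [hexp]
    rw [integral_add h6 (hT.const_mul _), integral_add h5 (hTF.const_mul _),
      integral_add h4 (hTG.const_mul _), integral_add h3 (hTFG.const_mul _),
      integral_add h2 (integrable_const _), integral_add h1 (hF.const_mul _),
      integral_add hFG (hG.const_mul _)]
    simp only [integral_const_mul, integral_const, probReal_univ, one_smul]
    rw [← ha, ← hb, ← ht]
  rw [hI]
  ring

end CSH
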